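import Summits.CriticalPhenomena.PercolationContinuityZ3.Theorems.PercNearOneGluingNoHeavyLowerTailSahiOneStepFibre
import HarnessLib

/-!
# One-step scheme: explicit parametrisation of the two-copy fibres

Support file (prover prim-ineq-prove-3 gen 16; `--supports stmt-CriticalPhenomena-4575`; memo
`run/shared/lean/prim/prim-ineq-prove-3/FINDING-G16-FIBRE-MAJ5.md` §2, §3.6).  No definitions, no named facts, no sorries, no `native_decide`.

`…SahiOneStepFibre.osMp_ind_ind_nonneg_of_fibre2` asks for the nonnegativity of the sum of `phi2 H A B` over the fibre
`{(S,S′) ∈ 𝒫(F)² : S ∩ S′ = I, S ∪ S′ = J}` for every key `(I, J)`.  Here the fibre is parametrised explicitly: it is empty unless `I ⊆ J ⊆ F`, and then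
it is the image of `R ↦ (I ∪ R, J ∖ R)`, `R ⊆ J ∖ I` (`fibre2_sum_eq`).  Hence the working form of the criterion, `osMp_ind_ind_nonneg_of_fibre2'`:
`(∀ I ⊆ J ⊆ F, 0 ≤ Σ_{R ⊆ J∖I} φ₂(I ∪ R, J ∖ R)) → 0 ≤ m′(H;A,B)` — the inner sum is G14's antipodal count (3*) on the cube `2^{J∖I}` for the traces of
`H, A, B` (coordinates in `I` open in both copies, outside `J` closed in both).
-/

noncomputable section

namespace Summit.CriticalPhenomena.PercolationContinuityZ3.Theorems

namespace SahiOneStep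

open MeasureTheory Finset
open Literature.Probability.Percolation (DeterminedBy)
open Literature.Probability.LatticeModels (prodBernoulli)
open Literature.Probability.Percolation.DecisionTree (ind)
open scoped Classical

variable {ι : Type*} [Fintype ι] [DecidableEq ι]

omit [Fintype ι] in
/-- The two-copy fibre over a key `(I, J)` is empty unless `I ⊆ J ⊆ F`. [this work] -/
theorem fibre2_filter_eq_empty (F : Finset ι) {I J : Finset ι} (h : ¬ (I ⊆ J ∧ J ⊆ F)) :
    (F.powerset ×ˢ F.powerset).filter (fun x => (x.1 ∩ x.2, x.1 ∪ x.2) = (I, J)) = ∅ := by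
  rw [Finset.filter_eq_empty_iff]
  intro x hx hk
  rw [Finset.mem_product, Finset.mem_powerset, Finset.mem_powerset] at hx
  rw [Prod.mk.injEq] at hk
  apply h
  rw [← hk.1, ← hk.2]
  exact ⟨Finset.inter_subset_left.trans Finset.subset_union_left, Finset.union_subset hx.1 hx.2⟩

omit [Fintype ι] in
/-- **Parametrisation of a two-copy fibre.**  For `I ⊆ J ⊆ F` the pairs `(S, S′)` of `F`-patterns with `S ∩ S′ = I`, `S ∪ S′ = J` are exactly
`(I ∪ R, J ∖ R)` for `R ⊆ J ∖ I`. [this work] -/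
theorem fibre2_sum_eq (F : Finset ι) {I J : Finset ι} (hIJ : I ⊆ J) (hJF : J ⊆ F) (f : Finset ι → Finset ι → ℝ) :
    ∑ x ∈ (F.powerset ×ˢ F.powerset).filter (fun x => (x.1 ∩ x.2, x.1 ∪ x.2) = (I, J)), f x.1 x.2 =
      ∑ R ∈ (J \ I).powerset, f (I ∪ R) (J \ R) := by
  symm
  refine Finset.sum_nbij' (fun R => (I ∪ R, J \ R)) (fun x => x.1 \ I) ?_ ?_ ?_ ?_ ?_
  · intro R hR
    rw [Finset.mem_powerset] at hR
    have hRJ : R ⊆ J := hR.trans Finset.sdiff_subset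
    have hRI : Disjoint R I := (Finset.subset_sdiff.1 hR).2
    rw [Finset.mem_filter, Finset.mem_product, Finset.mem_powerset, Finset.mem_powerset, Prod.mk.injEq]
    refine ⟨⟨(Finset.union_subset hIJ hRJ).trans hJF, Finset.sdiff_subset.trans hJF⟩, ?_, ?_⟩
    · ext i
      simp only [Finset.mem_inter, Finset.mem_union, Finset.mem_sdiff]
      constructor
      · rintro ⟨hi | hi, hj, hni⟩
        · exact hi
        · exact absurd hi hni
      · intro hi
        exact ⟨Or.inl hi, hIJ hi, fun hr => Finset.disjoint_left.1 hRI hr hi⟩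
    · ext i
      simp only [Finset.mem_union, Finset.mem_sdiff]
      constructor
      · rintro ((hi | hi) | ⟨hj, -⟩)
        · exact hIJ hi
        · exact hRJ hi
        · exact hj
      · intro hj
        by_cases hr : i ∈ R
        · exact Or.inl (Or.inr hr)
        · exact Or.inr ⟨hj, hr⟩
  · intro x hx
    rw [Finset.mem_filter, Prod.mk.injEq] at hx
    rw [Finset.mem_powerset, ← hx.2.2, ← hx.2.1]
    intro i hi
    rw [Finset.mem_sdiff] at hi ⊢
    exact ⟨Finset.mem_union_left _ hi.1, fun h => hi.2 h⟩
  · intro R hR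
    rw [Finset.mem_powerset] at hR
    have hRI : Disjoint R I := (Finset.subset_sdiff.1 hR).2
    show (I ∪ R) \ I = R
    rw [Finset.union_sdiff_left]
    exact Finset.sdiff_eq_self_of_disjoint hRI
  · intro x hx
    rw [Finset.mem_filter, Prod.mk.injEq] at hx
    obtain ⟨-, h1, h2⟩ := hx
    show (I ∪ x.1 \ I, J \ (x.1 \ I)) = x
    have e1 : I ∪ x.1 \ I = x.1 := by
      rw [Finset.union_sdiff_self_eq_union, Finset.union_eq_right]
      rw [← h1]; exact Finset.inter_subset_left
    have e2 : J \ (x.1 \ I) = x.2 := by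
      ext i
      rw [Finset.mem_sdiff, Finset.mem_sdiff, ← h2, Finset.mem_union, ← h1, Finset.mem_inter]
      tauto
    rw [e1, e2]
  · intro R _; rfl

/-- **Working form of the two-copy fibre criterion.**  If for all `I ⊆ J ⊆ F` the antipodal sum `Σ_{R ⊆ J∖I} φ₂(I ∪ R, J ∖ R)` is nonnegative, then
`m′(H;A,B) ≥ 0`. [this work] -/
theorem osMp_ind_ind_nonneg_of_fibre2' (p : ι → unitInterval) {F : Finset ι} {H A B : Set (Set ι)} (hH : DeterminedBy H (↑F : Set ι))
    (hA : DeterminedBy A (↑F : Set ι)) (hB : DeterminedBy B (↑F : Set ι))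
    (hfib : ∀ I J : Finset ι, I ⊆ J → J ⊆ F → 0 ≤ ∑ R ∈ (J \ I).powerset, phi2 H A B (I ∪ R) (J \ R)) :
    0 ≤ osMp p H (ind A) (ind B) := by
  refine osMp_ind_ind_nonneg_of_fibre2 p hH hA hB fun IJ => ?_
  obtain ⟨I, J⟩ := IJ
  by_cases h : I ⊆ J ∧ J ⊆ F
  · rw [fibre2_sum_eq F h.1 h.2 (phi2 H A B)]
    exact hfib I J h.1 h.2
  · rw [fibre2_filter_eq_empty F h, Finset.sum_empty]

end SahiOneStep

end Summit.CriticalPhenomena.PercolationContinuityZ3.Theorems
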